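import Mathlib.Data.Fintype.Shrink
import Literature.AnabelianGeometry.SemiGraphs.CoveringFull

/-!
# Coproduct bookkeeping for the essential surjectivity of `B(𝒢)_{/A} ⥤ B(𝒢_A)` ([SemiAnbd] Def. 2.2 (i) — brick G7, preparations)

Mochizuki, *Semi-graphs of anabelioids*, Publ. RIMS **42** (2006) 221–322, §2 p. 23
[cite: MochizukiSemiAnbd2006, Def. 2.2(i) p.23].  To reassemble an object of `B(𝒢)_{/A}` from an object
`D` of `B(𝒢_A)` one sets `X_v := ∐_{(v,P)} D_{(v,P)}` and must produce `ψ_b : b^* X_v ≅ X_e`; this file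
provides the coproduct bookkeeping:

* generic cofan lemmas: summands may be replaced by isomorphic ones (`cofan_isColimit_of_iso_summands`),
  EMPTY summands may be dropped (`cofan_isColimit_subtype`), a coproduct of coproducts is a coproduct over
  the sigma type (`cofan_isColimit_sigma`);
* `isColimit_cofan_gluing` — for `U → P`, `b^* U` is the coproduct of the gluing objects
  `b^* U ×_{b^* P} Q` over the branches `(b, Q)` of `𝔾_A` abutting to `(v, P)`;
* `isColimit_cofan_branch` — hence `b^*(∐_{(v,P)} F_{(v,P)})` (`F_{(v,P)} → P`) is the coproduct, over ALL
  edges `(e, Q)` of `𝔾_A` above `e ∋ b`, of the gluing object of the branch `(b, Q)` at its vertex.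
-/

namespace Literature.AnabelianGeometry.SemiGraphs

open CategoryTheory CategoryTheory.Limits CategoryTheory.PreGaloisCategory
open Literature.AnabelianGeometry.Anabelioids

universe w'' w' w v₁ u₁ u

-- Mathlib's `Over.pullback` / `Over.star` simp lemmas (`pullback.lift_fst`, …) only fire under the
-- pre-v4.2x defeq transparency behaviour, exactly as in `Mathlib/CategoryTheory/Comma/Over/Pullback.lean`.
set_option backward.isDefEq.respectTransparency false

/-! ### Generic cofan lemmas -/

/-- A coproduct cofan stays a coproduct cofan after replacing the summands by isomorphic ones.
[cite: MochizukiSemiAnbd2006, Def. 2.2(i) p.23] -/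
theorem cofan_isColimit_of_iso_summands {C : Type u₁} [Category.{v₁} C] {I : Type w} {F G : I → C}
    (e : ∀ i, F i ≅ G i) {X : C} (ι : ∀ i, G i ⟶ X) (hc : IsColimit (Cofan.mk X ι)) :
    Nonempty (IsColimit (Cofan.mk X (fun i => (e i).hom ≫ ι i))) := by
  let α : Discrete.functor F ≅ Discrete.functor G := Discrete.natIso (fun i => e i.as)
  have h2 : IsColimit ((Cocone.precompose α.hom).obj (Cofan.mk X ι)) :=
    (IsColimit.precomposeHomEquiv α _).symm hc
  refine ⟨IsColimit.ofIsoColimit h2 (Cocone.ext (Iso.refl _) ?_)⟩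
  rintro ⟨i⟩
  simp only [α, Cofan.mk, Iso.refl_hom, Category.comp_id, Cocone.precompose_obj_ι, NatTrans.comp_app,
    Discrete.natIso_hom_app, Discrete.natTrans_app]

/-- EMPTY summands may be dropped from a coproduct cofan. [cite: MochizukiSemiAnbd2006, Def. 2.2(i) p.23] -/
theorem cofan_isColimit_subtype {C : Type u₁} [Category.{v₁} C] {I : Type w} (p : I → Prop) {F : I → C}
    {X : C} (ι : ∀ i, F i ⟶ X) (hc : IsColimit (Cofan.mk X ι)) (h0 : ∀ i, ¬ p i → IsInitial (F i)) :
    Nonempty (IsColimit (Cofan.mk X (fun i : {i // p i} => ι i.1))) := by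
  classical
  refine ⟨Cofan.IsColimit.mk _
    (fun s => Cofan.IsColimit.desc hc (fun i => if hi : p i then s.inj ⟨i, hi⟩ else (h0 i hi).to _))
    (fun s i => ?_) (fun s g hg => ?_)⟩
  · change ι i.1 ≫ _ = _
    have := Cofan.IsColimit.fac hc (fun i => if hi : p i then s.inj ⟨i, hi⟩ else (h0 i hi).to _) i.1
    rw [cofan_mk_inj] at this
    rw [this, dif_pos i.2]
  · refine Cofan.IsColimit.hom_ext hc _ _ (fun i => ?_)
    rw [Cofan.IsColimit.fac]
    by_cases hi : p i
    · rw [dif_pos hi, ← hg ⟨i, hi⟩]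
      rfl
    · exact (h0 i hi).hom_ext _ _

/-- A coproduct of coproducts is a coproduct over the sigma type.
[cite: MochizukiSemiAnbd2006, Def. 2.2(i) p.23] -/
theorem cofan_isColimit_sigma {C : Type u₁} [Category.{v₁} C] {I : Type w} {J : I → Type w'}
    {F : ∀ i, J i → C} {Y : I → C} (ι : ∀ i j, F i j ⟶ Y i) (hc : ∀ i, IsColimit (Cofan.mk (Y i) (ι i)))
    {X : C} (κ : ∀ i, Y i ⟶ X) (hd : IsColimit (Cofan.mk X κ)) :
    Nonempty (IsColimit (Cofan.mk X (fun ij : Σ i, J i => ι ij.1 ij.2 ≫ κ ij.1))) := by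
  refine ⟨Cofan.IsColimit.mk _
    (fun s => Cofan.IsColimit.desc hd (fun i => Cofan.IsColimit.desc (hc i) (fun j => s.inj ⟨i, j⟩)))
    (fun s ij => ?_) (fun s g hg => ?_)⟩
  · obtain ⟨i, j⟩ := ij
    change (ι i j ≫ κ i) ≫ _ = _
    have h1 := Cofan.IsColimit.fac hd (fun i => Cofan.IsColimit.desc (hc i) (fun j => s.inj ⟨i, j⟩)) i
    have h2 := Cofan.IsColimit.fac (hc i) (fun j => s.inj ⟨i, j⟩) j
    rw [cofan_mk_inj] at h1 h2
    rw [Category.assoc, h1, h2]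
  · refine Cofan.IsColimit.hom_ext hd _ _ (fun i => ?_)
    rw [Cofan.IsColimit.fac]
    refine Cofan.IsColimit.hom_ext (hc i) _ _ (fun j => ?_)
    rw [Cofan.IsColimit.fac, cofan_mk_inj, cofan_mk_inj, ← Category.assoc]
    exact hg ⟨i, j⟩

namespace SemiGraphOfAnabelioids

namespace BObj

variable {𝒢 : SemiGraphOfAnabelioids.{v₁, u₁, u}} (A : 𝒢.BObj)

/-! ### `b^* U` is the coproduct of the gluing objects -/

/-- A decorated branch `(b, c')` abuts to `(v, c)` once `σ_b c' = c`. [cite: MochizukiSemiAnbd2006, Def. 2.2(i) p.23] -/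
theorem total_abuts_of_σ_eq {b : 𝒢.graph.Branch} {v : 𝒢.graph.Vertex} (h : 𝒢.graph.abuts b = some v)
    {c : Shrink.{u} (π₀Obj (A.S v))} {c' : Shrink.{u} (π₀Obj (A.T (𝒢.graph.edgeOf b)))}
    (hσ : A.fibreData.σ b v h c' = c) : A.fibreData.total.abuts ⟨b, c'⟩ = some ⟨v, c⟩ := by
  rw [A.total_abuts_mk h c', hσ]

/-- **`b^* U = ∐ b^* U ×_{b^* P} Q`** over the branches `(b, Q)` of `𝔾_A` abutting to `(v, P)`, for any
`U → P`: the component decomposition of `b^* U` along `T_e`, with the empty pieces (components not under `P`)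
dropped and the others identified with the gluing objects. [cite: MochizukiSemiAnbd2006, Def. 2.2(i) p.23] -/
theorem isColimit_cofan_gluing {b : 𝒢.graph.Branch} {v : 𝒢.graph.Vertex} (h : 𝒢.graph.abuts b = some v)
    (c : Shrink.{u} (π₀Obj (A.S v))) (U : Over ((A.vComp ⟨v, c⟩).1 : 𝒢.V (A.fibreData.proj.vertexMap ⟨v, c⟩))) :
    Nonempty (IsColimit (Cofan.mk ((𝒢.pull b v h).pullback.obj U.left)
      (fun c' : {c' : Shrink.{u} (π₀Obj (A.T (𝒢.graph.edgeOf b))) // A.fibreData.σ b v h c' = c} =>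
        (pullback.fst _ _ :
          ((A.gluingAt ⟨b, c'.1⟩ ⟨v, c⟩ (A.total_abuts_of_σ_eq h c'.2)).obj U).left ⟶ _)))) := by
  obtain ⟨hc'⟩ := A.isColimit_cofan_edges (𝒢.graph.edgeOf b)
    (((Over.post (𝒢.pull b v h).pullback).obj U).hom ≫
      (𝒢.pull b v h).pullback.map (A.vComp ⟨v, c⟩).1.arrow ≫ (A.ψ b v h).hom)
  obtain ⟨h1⟩ := cofan_isColimit_subtype (fun c' => A.fibreData.σ b v h c' = c) _ hc'
    (fun c' hσ => (A.isInitial_summand h c c' hσ U).some)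
  obtain ⟨h2⟩ := cofan_isColimit_of_iso_summands
    (fun c' : {c' : Shrink.{u} (π₀Obj (A.T (𝒢.graph.edgeOf b))) // A.fibreData.σ b v h c' = c} =>
      (A.isPullback_gluing_summand h c c'.1 (A.total_abuts_of_σ_eq h c'.2) U).isoPullback) _ h1
  refine ⟨IsColimit.ofIsoColimit h2 (Cocone.ext (Iso.refl _) (fun j => ?_))⟩
  obtain ⟨c'⟩ := j
  rw [Iso.refl_hom, Category.comp_id]
  exact (A.isPullback_gluing_summand h c c'.1 (A.total_abuts_of_σ_eq h c'.2) U).isoPullback_hom_fst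

/-- **`b^*(∐_{(v,P)} U_{(v,P)})` is the coproduct, over all edges `(e, Q)` of `𝔾_A` above the edge `e` of
`b`, of the gluing objects `b^* U_{(v, σ_b Q)} ×_{b^* σ_b Q} Q`** (each branch `(b, Q)` abutting to exactly
one vertex `(v, σ_b Q)`). [cite: MochizukiSemiAnbd2006, Def. 2.2(i) p.23] -/
theorem isColimit_cofan_branch {b : 𝒢.graph.Branch} {v : 𝒢.graph.Vertex} (h : 𝒢.graph.abuts b = some v)
    (F : Shrink.{u} (π₀Obj (A.S v)) → 𝒢.V v)
    (q : ∀ c, F c ⟶ ((A.vComp ⟨v, c⟩).1 : 𝒢.V (A.fibreData.proj.vertexMap ⟨v, c⟩))) :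
    Nonempty (IsColimit (Cofan.mk ((𝒢.pull b v h).pullback.obj (∐ F))
      (fun c' : Shrink.{u} (π₀Obj (A.T (𝒢.graph.edgeOf b))) =>
        (pullback.fst _ _ :
          ((A.gluingAt ⟨b, c'⟩ ⟨v, A.fibreData.σ b v h c'⟩ (A.total_abuts_mk h c')).obj
            (Over.mk (q (A.fibreData.σ b v h c')))).left ⟶ _) ≫
          (𝒢.pull b v h).pullback.map (Sigma.ι F (A.fibreData.σ b v h c'))))) := by
  haveI : PreservesFiniteColimits (𝒢.pull b v h).pullback := (𝒢.pull b v h).property.2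
  have hd := isColimitCofanMkObjOfIsColimit (𝒢.pull b v h).pullback _ _ (coproductIsCoproduct F)
  obtain ⟨hs⟩ := cofan_isColimit_sigma
    (fun c (c' : {c' : Shrink.{u} (π₀Obj (A.T (𝒢.graph.edgeOf b))) // A.fibreData.σ b v h c' = c}) =>
      (pullback.fst _ _ :
        ((A.gluingAt ⟨b, c'.1⟩ ⟨v, c⟩ (A.total_abuts_of_σ_eq h c'.2)).obj (Over.mk (q c))).left ⟶ _))
    (fun c => (A.isColimit_cofan_gluing h c (Over.mk (q c))).some) _ hd
  exact cofan_isColimit_reindex (Equiv.sigmaFiberEquiv (A.fibreData.σ b v h)).symm _ hs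

end BObj

end SemiGraphOfAnabelioids

end Literature.AnabelianGeometry.SemiGraphs
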